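import Mathlib
import HarnessLib
import Summits.HubbardSuperconductivity.HubbardSuperconductivity.Theorems.KLProgrammePerturbedFermiCurveWindowJets

/-!
# Route `KLProgramme` — definitions: the FREE band's polar-jet TABLE on a level window (the named numerical hypothesis of the
# window-specific Jacobian-jet bundle, KLCert pattern) and the four certified tables of record

Cell `gate-hubbard-kl`, seat hubbard-kl-k3c3-p3 (g7; row «implicit-function / monotonicity route for μ(n)»); engine-flow child
`KLRegimeEngineV17F2` (stmt-HubbardSuperconductivity-20437), stub (C) `stub_twoLeg_curvature`, plan (R47r) (KL STATUS l.3231): «replace the generic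
`klJacG` table by a window-specific CERTIFIED bundle (kit interval arithmetic on `klWindowC ± 3/80`, KLCert pattern)».  Free band
`ε₀(k) = -2(cos k₁ + cos k₂)`, polar level function `F(θ, t) = ε₀(t·dir θ)` (`rayDispersion`), free Fermi radius `u = bandFermiRadius μ`
(`F(θ, u(θ)) = μ`), radial slope `D(θ) = ∂_tF(θ, u(θ))` (`rayDispersionDt θ (bandFermiRadius μ θ)` — the `∂_με`-transversality of `BandBounds.Dtmin`),
polar Jacobian `J = u/D` (c4a-1's `levelChartJac` at the bare frame, `…C4aJacobianFrameJets`).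

* `PolarJetTable` — sixteen numbers: `umin ≤ u ≤ umax`, `Dtmin ≤ D`, `|u^{(k)}| ≤ R_k` (`k = 1…4`), `|D^{(k)}| ≤ D_k` (`k = 1…4`),
  `|J^{(k)}| ≤ G_k` (`k = 0…4`);
* `FreeBandPolarJets a b T : Prop` — THE named numerical hypothesis: the table `T` bounds the free band's polar tower uniformly over the
  level window `μ ∈ [a, b]` and all angles (derivatives as nested `deriv`, the lineage's convention);
* the tables of record `klwjTableA` (window `[-87/80, -9/80] = klWindowC ± 3/80`, c4a-1's levels; elementwise max of this seat's
  two-engine j284931 and c4a-1's j284476 — they agree to 2.3 %), `klwjTableB` (window `[-1.1, -0.1]` = the band range of `frame_sizes_of_frameOK`, ⊇ `klWindowC ± 3/80`),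
  `klwjTableC` (`klWindowC = [-1.05, -0.15]`), `klwjTableX` (`[-1.1375, -0.0625]` = `klWindowC ± 3/80 ± 1/20`) and the named statements
  `KlwjCertA/B/C/X : Prop` — CERTIFIED by kit j284449 (control runs j284117, j284240): two-engine (mpmath.iv 40 dps, python-flint arb 180 bit)
  interval TAYLOR-JET arithmetic on `(θ, t)`-boxes (`θ ∈ [0, π/4]` by `D₄`, 512 × 753 boxes, implicit differentiation solved order by order
  INSIDE the interval arithmetic), a box charged to a level cell iff the enclosure of `F` meets it, every number the outward hull of both
  engines (they agree to `3·10⁻³`), then rounded outward to 4 significant digits; certified/natural ≤ 1.02 at orders ≤ 2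
  (memo HOME/hubbard-kl-k3c3-p3/WINDOW-JETS.md, evidence on the item).  Against the generic constants: `R₁ = 1.549` on `[-1.1, -0.1]` vs the
  uniform `(4+2A)π√2/(Dt_min − 2A) ≈ 28.5`; `G₂ = 469.9` vs `klJacG … 2 ≈ 10⁵–10⁶`.
* `FreeBandPolarJets.mono` (sub-window), and the field projections.

* §3 the BRIDGES to the consumer side `…PerturbedFermiCurveWindowJets` (p549342): `bandBounds_of_polarJets` (a `BandBounds a b` whose
  `Dtmin` IS the table's, all other constants from any given bundle) and `frame_polar_tower_of_polarJets` (= `frame_polar_tower_of_window`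
  fed by the table: the frame's tower `u_K ≤ umax + W₀`, `|u_K^{(k)}| ≤ R_k + W_k` at every angle).  Nothing here is asserted about the Hubbard model; the `KlwjCert*` are
hypotheses to be carried (KLCert pattern, as `KLCert.EnclosuresB1g` on the certificate half), not axioms.
References: BGM 2006 §2.4 Lemma 2.1 (2.40) [cite: BenfattoGiulianiMastropietro2006]; CERT-LEAN.md §0–§1 (the KLCert pattern).
-/

noncomputable section

namespace Summit.HubbardSuperconductivity.HubbardSuperconductivity.Theorems.PerturbedFermiCurve

set_option linter.dupNamespace false -- summit = problem name (single-conjunct summit), D-0017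

open Real Set
open Literature.MathematicalPhysics.QuantumLattice Literature.MathematicalPhysics.QuantumLattice.BandSectorCounting
open Summit.HubbardSuperconductivity.HubbardSuperconductivity.Theorems.DispersionFlow

/-- **A polar-jet table** of the free band on a level window: range and transversality (`umin`, `umax`, `Dtmin`), the radius tower
`R1 … R4` (`sup|u^{(k)}|`), the radial-slope tower `D1 … D4` (`sup|D^{(k)}|`, `D = ∂_tF(θ, u)`) and the polar-Jacobian tower `G0 … G4`
(`sup|J^{(k)}|`, `J = u/D`). -/
structure PolarJetTable where
  /-- `umin ≤ u` -/
  umin : ℝ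
  /-- `u ≤ umax` -/
  umax : ℝ
  /-- `Dtmin ≤ D = ∂_tF(θ, u(θ))` -/
  Dtmin : ℝ
  /-- `|u′| ≤ R1` -/
  R1 : ℝ
  /-- `|u″| ≤ R2` -/
  R2 : ℝ
  /-- `|u‴| ≤ R3` -/
  R3 : ℝ
  /-- `|u⁗| ≤ R4` -/
  R4 : ℝ
  /-- `|D′| ≤ D1` -/
  D1 : ℝ
  /-- `|D″| ≤ D2` -/
  D2 : ℝ
  /-- `|D‴| ≤ D3` -/
  D3 : ℝ
  /-- `|D⁗| ≤ D4` -/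
  D4 : ℝ
  /-- `|J| ≤ G0` -/
  G0 : ℝ
  /-- `|J′| ≤ G1` -/
  G1 : ℝ
  /-- `|J″| ≤ G2` -/
  G2 : ℝ
  /-- `|J‴| ≤ G3` -/
  G3 : ℝ
  /-- `|J⁗| ≤ G4` -/
  G4 : ℝ

/-- The free band's radial slope along its own Fermi curve at level `μ`: `D_μ(θ) = ∂_tF(θ, u_μ(θ))`. -/
def freeRadialSlope (μ : ℝ) : ℝ → ℝ := fun θ => rayDispersionDt θ (bandFermiRadius μ θ)

/-- The free band's polar Jacobian along its own Fermi curve at level `μ`: `J_μ(θ) = u_μ(θ)/D_μ(θ)`. -/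
def freePolarJac (μ : ℝ) : ℝ → ℝ := fun θ => bandFermiRadius μ θ / rayDispersionDt θ (bandFermiRadius μ θ)

/-- **`FreeBandPolarJets a b T`** — THE named numerical hypothesis: on the level window `μ ∈ [a, b]`, at every angle `θ`, the free
band's radius, radial slope and polar Jacobian and their first four angular derivatives are bounded by the table `T`. -/
def FreeBandPolarJets (a b : ℝ) (T : PolarJetTable) : Prop :=
  ∀ μ ∈ Icc a b, ∀ θ : ℝ,
    (T.umin ≤ bandFermiRadius μ θ ∧ bandFermiRadius μ θ ≤ T.umax ∧ T.Dtmin ≤ rayDispersionDt θ (bandFermiRadius μ θ)) ∧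
    (|deriv (bandFermiRadius μ) θ| ≤ T.R1 ∧ |deriv (deriv (bandFermiRadius μ)) θ| ≤ T.R2 ∧
      |deriv (deriv (deriv (bandFermiRadius μ))) θ| ≤ T.R3 ∧ |deriv (deriv (deriv (deriv (bandFermiRadius μ)))) θ| ≤ T.R4) ∧
    (|deriv (freeRadialSlope μ) θ| ≤ T.D1 ∧ |deriv (deriv (freeRadialSlope μ)) θ| ≤ T.D2 ∧
      |deriv (deriv (deriv (freeRadialSlope μ))) θ| ≤ T.D3 ∧ |deriv (deriv (deriv (deriv (freeRadialSlope μ)))) θ| ≤ T.D4) ∧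
    (|freePolarJac μ θ| ≤ T.G0 ∧ |deriv (freePolarJac μ) θ| ≤ T.G1 ∧ |deriv (deriv (freePolarJac μ)) θ| ≤ T.G2 ∧
      |deriv (deriv (deriv (freePolarJac μ))) θ| ≤ T.G3 ∧ |deriv (deriv (deriv (deriv (freePolarJac μ)))) θ| ≤ T.G4)

/-- **Table of record, window `[-87/80, -9/80] = klWindowC ± 3/80`** (c4a-1's levels): the elementwise MAX of two independent certificates —
kit j284931 (this seat: mpmath.iv + arb jet arithmetic, cells of width `1/80`) and c4a-1's kit j284476 (mpmath.iv, bisection + Taylor recursion) —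
rounded outward to 4 significant digits; the two agree entrywise to `2.3 %`. -/
def klwjTableA : PolarJetTable :=
  ⟨1.829, 2.807, 0.6585, 1.5, 21.12, 225.9, 7241, 4.606, 55.74, 515.6, 16060, 4.261, 16.43, 392.8, 7550, 314600⟩

/-- **Table of record, window `[-1.1, -0.1]`** (the band range of `frame_sizes_of_frameOK`; contains `klWindowC ± 3/80`): kit j284449,
cells `[-1.1, -0.1]`, outward hull of both engines rounded outward to 4 significant digits. -/
def klwjTableB : PolarJetTable :=
  ⟨1.826, 2.826, 0.6225, 1.549, 22.82, 256.7, 8683, 4.696, 59.42, 578.1, 19070, 4.538, 18.62, 469.9, 9648, 422400⟩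

/-- **Table of record, `klWindowC = [-1.05, -0.15]`**: kit j284449, cells `[-1.05, -0.15]`. -/
def klwjTableC : PolarJetTable :=
  ⟨1.844, 2.754, 0.7577, 1.375, 17.26, 164.2, 4568, 4.373, 47.3, 386.1, 10420, 3.634, 12.02, 249.7, 4150, 149600⟩

/-- **Table of record, window `[-1.1375, -0.0625]`** (`klWindowC ± 3/80 ± 1/20`): kit j284449, cells `[-1.15, -0.05]`. -/
def klwjTableX : PolarJetTable :=
  ⟨1.806, 2.919, 0.4433, 1.826, 35.51, 545.6, 25390, 5.15, 86.17, 1167, 53460, 6.582, 38.77, 1360, 40670, 2441000⟩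

/-- **`KlwjCertA`** — the certified statement on `[-87/80, -9/80] = klWindowC ± 3/80` (evidence: kit j284931 + c4a-1's j284476 on
stmt-HubbardSuperconductivity-20437). -/
def KlwjCertA : Prop := FreeBandPolarJets (-1.0875) (-0.1125) klwjTableA

/-- **`KlwjCertB`** — the certified statement on `[-1.1, -0.1]` (evidence: kit j284449 + manifest on stmt-HubbardSuperconductivity-20437). -/
def KlwjCertB : Prop := FreeBandPolarJets (-1.1) (-0.1) klwjTableB

/-- **`KlwjCertC`** — the certified statement on `klWindowC = [-1.05, -0.15]`. -/
def KlwjCertC : Prop := FreeBandPolarJets (-1.05) (-0.15) klwjTableC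

/-- **`KlwjCertX`** — the certified statement on `[-1.1375, -0.0625]`. -/
def KlwjCertX : Prop := FreeBandPolarJets (-1.1375) (-0.0625) klwjTableX

namespace FreeBandPolarJets

variable {a b : ℝ} {T : PolarJetTable} (h : FreeBandPolarJets a b T)
include h

/-- **Sub-window**: the table holds on every `[a′, b′] ⊂ [a, b]`. -/
theorem mono {a' b' : ℝ} (ha : a ≤ a') (hb : b' ≤ b) : FreeBandPolarJets a' b' T :=
  fun μ hμ θ => h μ ⟨ha.trans hμ.1, hμ.2.trans hb⟩ θ

/-- `umin ≤ u`. -/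
theorem umin_le : ∀ μ ∈ Icc a b, ∀ θ : ℝ, T.umin ≤ bandFermiRadius μ θ := fun μ hμ θ => (h μ hμ θ).1.1

/-- `u ≤ umax`. -/
theorem le_umax : ∀ μ ∈ Icc a b, ∀ θ : ℝ, bandFermiRadius μ θ ≤ T.umax := fun μ hμ θ => (h μ hμ θ).1.2.1

/-- `Dtmin ≤ ∂_tF(θ, u(θ))` — the `Dt_ge` field of a `BandBounds a b` with `Dtmin = T.Dtmin`. -/
theorem Dtmin_le : ∀ μ ∈ Icc a b, ∀ θ : ℝ, T.Dtmin ≤ rayDispersionDt θ (bandFermiRadius μ θ) := fun μ hμ θ => (h μ hμ θ).1.2.2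

/-- `|u′| ≤ R1`. -/
theorem abs_deriv_le : ∀ μ ∈ Icc a b, ∀ θ : ℝ, |deriv (bandFermiRadius μ) θ| ≤ T.R1 := fun μ hμ θ => (h μ hμ θ).2.1.1

/-- `|u″| ≤ R2`. -/
theorem abs_deriv_two_le : ∀ μ ∈ Icc a b, ∀ θ : ℝ, |deriv (deriv (bandFermiRadius μ)) θ| ≤ T.R2 :=
  fun μ hμ θ => (h μ hμ θ).2.1.2.1

/-- `|u‴| ≤ R3`. -/
theorem abs_deriv_three_le : ∀ μ ∈ Icc a b, ∀ θ : ℝ, |deriv (deriv (deriv (bandFermiRadius μ))) θ| ≤ T.R3 :=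
  fun μ hμ θ => (h μ hμ θ).2.1.2.2.1

/-- `|u⁗| ≤ R4`. -/
theorem abs_deriv_four_le : ∀ μ ∈ Icc a b, ∀ θ : ℝ, |deriv (deriv (deriv (deriv (bandFermiRadius μ)))) θ| ≤ T.R4 :=
  fun μ hμ θ => (h μ hμ θ).2.1.2.2.2

/-- `|J^{(k)}| ≤ G_k`, `k = 0, 1, 2` (the SHARP orders of c4a-1's `hJjet`). -/
theorem abs_polarJac_le : ∀ μ ∈ Icc a b, ∀ θ : ℝ,
    |freePolarJac μ θ| ≤ T.G0 ∧ |deriv (freePolarJac μ) θ| ≤ T.G1 ∧ |deriv (deriv (freePolarJac μ)) θ| ≤ T.G2 :=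
  fun μ hμ θ => ⟨(h μ hμ θ).2.2.2.1, (h μ hμ θ).2.2.2.2.1, (h μ hμ θ).2.2.2.2.2.1⟩

end FreeBandPolarJets

/-! ## §3 Bridges to the consumer side (`…PerturbedFermiCurveWindowJets`) -/

section Bridge

variable {a b : ℝ} {T : PolarJetTable}

/-- **A `BandBounds a b` carrying the table's `Dtmin`** (all other constants from any given bundle `B₀`): the `B` to feed the lineage's
frame theorems so that `ρ₀ = T.Dtmin − 2A₁`. -/
theorem bandBounds_of_polarJets (B₀ : BandBounds a b) (h : FreeBandPolarJets a b T) (hT : 0 < T.Dtmin) :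
    ∃ B : BandBounds a b, B.Dtmin = T.Dtmin ∧ B.umin = B₀.umin ∧ B.smax = B₀.smax ∧ B.A2 = B₀.A2 ∧ B.hmin = B₀.hmin ∧
      B.amin = B₀.amin ∧ B.rhomin = B₀.rhomin ∧ B.cmax = B₀.cmax :=
  ⟨{ B₀ with Dtmin := T.Dtmin, Dtmin_pos := hT, Dt_ge := h.Dtmin_le }, rfl, rfl, rfl, rfl, rfl, rfl, rfl, rfl⟩

set_option maxSynthPendingDepth 4 in -- nested operator-norm instances (fourth Fréchet derivatives of the frame)
/-- **The frame's polar tower from a polar-jet table** (`frame_polar_tower_of_window` fed by `FreeBandPolarJets a b T`): for a frame `K`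
with per-order sizes `A₀ … A₄` (`2A₁ < B.Dtmin`, level `ν` with margins `A₀` inside `[a, b]`) and numbers `W₁ … W₄` dominating the closed-form
widths, at every angle: the five differences to the free tower, the range `u_K ≤ T.umax + A₀/(B.Dtmin − 2A₁)` and
`|u_K^{(k)}| ≤ T.R_k + W_k`, `k = 1 … 4`. [cite: BenfattoGiulianiMastropietro2006, §2.4 Lemma 2.1 (2.40)] -/
theorem frame_polar_tower_of_polarJets (h : FreeBandPolarJets a b T) (B : BandBounds a b) {K : TrigPolyC4v} {A₀ A₁ A₂ A₃ A₄ : ℝ}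
    (hA₀ : ∀ p : Momentum, ‖iteratedFDeriv ℝ 0 (frameShift K) p‖ ≤ A₀)
    (hA₁ : ∀ p : Momentum, ‖iteratedFDeriv ℝ 1 (frameShift K) p‖ ≤ A₁)
    (hA₂ : ∀ p : Momentum, ‖iteratedFDeriv ℝ 2 (frameShift K) p‖ ≤ A₂)
    (hA₃ : ∀ p : Momentum, ‖iteratedFDeriv ℝ 3 (frameShift K) p‖ ≤ A₃)
    (hA₄ : ∀ p : Momentum, ‖iteratedFDeriv ℝ 4 (frameShift K) p‖ ≤ A₄)
    (hA₁Dt : 2 * A₁ < B.Dtmin) {ν : ℝ} (hlo : a ≤ ν - A₀) (hhi : ν + A₀ ≤ b) {W₁ W₂ W₃ W₄ : ℝ}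
    (hW₁ : ((4 + 2 * A₁) * (A₀ / (B.Dtmin - 2 * A₁)) +
        (π * Real.sqrt 2 + (4 + 2 * A₁) * (π * Real.sqrt 2) / (B.Dtmin - 2 * A₁)) * ((4 + 0) * (A₀ / (B.Dtmin - 2 * A₁)) + 2 * A₁)) /
        (B.Dtmin - 2 * A₁) ≤ W₁)
    (hW₂ : A₀ / (B.Dtmin - 2 * A₁) +
        (((4 + 0) * (A₀ / (B.Dtmin - 2 * A₁)) + 4 * A₂) * ((T.R1 + W₁) + π * Real.sqrt 2) ^ 2 +
          2 * (4 + 0) * ((T.R1 + W₁) + π * Real.sqrt 2) * (W₁ + A₀ / (B.Dtmin - 2 * A₁)) +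
          ((4 + 0) * (A₀ / (B.Dtmin - 2 * A₁)) + 2 * A₁) * (2 * (T.R1 + W₁) + π * Real.sqrt 2) +
          (4 + 2 * A₁) * (A₀ / (B.Dtmin - 2 * A₁) + 2 * W₁) +
          (T.R2 + π * Real.sqrt 2) * ((4 + 0) * (A₀ / (B.Dtmin - 2 * A₁)) + 2 * A₁)) / (B.Dtmin - 2 * A₁) ≤ W₂)
    (hW₃ : (((4 + 0) * (A₀ / (B.Dtmin - 2 * A₁)) + 8 * A₃) * ((T.R1 + W₁) + π * Real.sqrt 2) ^ 3 +
        3 * (4 + 0) * (W₁ + A₀ / (B.Dtmin - 2 * A₁)) * ((T.R1 + W₁) + π * Real.sqrt 2) ^ 2 +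
        3 * (((4 + 0) * (A₀ / (B.Dtmin - 2 * A₁)) + 4 * A₂) * ((T.R1 + W₁) + π * Real.sqrt 2) * ((T.R2 + W₂) + 2 * (T.R1 + W₁) + π * Real.sqrt 2) +
          (4 + 0) * ((W₂ + 2 * W₁ + A₀ / (B.Dtmin - 2 * A₁)) * ((T.R1 + W₁) + π * Real.sqrt 2) +
            ((T.R2 + W₂) + 2 * (T.R1 + W₁) + π * Real.sqrt 2) * (W₁ + A₀ / (B.Dtmin - 2 * A₁)))) +
        ((4 + 0) * (A₀ / (B.Dtmin - 2 * A₁)) + 2 * A₁) * (3 * (T.R2 + W₂) + 3 * (T.R1 + W₁) + π * Real.sqrt 2) +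
        (4 + 2 * A₁) * (3 * W₂ + 3 * W₁ + A₀ / (B.Dtmin - 2 * A₁)) +
        T.R3 * ((4 + 0) * (A₀ / (B.Dtmin - 2 * A₁)) + 2 * A₁)) / (B.Dtmin - 2 * A₁) ≤ W₃)
    (hW₄ : ((4 * (A₀ / (B.Dtmin - 2 * A₁)) + 2 * 0 + 16 * A₄) * ((T.R1 + W₁) + π * Real.sqrt 2) ^ 4 +
        4 * (4 + 0) * (W₁ + A₀ / (B.Dtmin - 2 * A₁)) * ((T.R1 + W₁) + π * Real.sqrt 2) ^ 3 +
        6 * ((((4 + 0) * (A₀ / (B.Dtmin - 2 * A₁)) + 8 * A₃) * ((T.R1 + W₁) + π * Real.sqrt 2) ^ 2 * ((T.R2 + W₂) + 2 * (T.R1 + W₁) + π * Real.sqrt 2) +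
          (4 + 0) * ((W₂ + 2 * W₁ + A₀ / (B.Dtmin - 2 * A₁)) * ((T.R1 + W₁) + π * Real.sqrt 2) ^ 2 +
            2 * ((T.R1 + W₁) + π * Real.sqrt 2) * ((T.R2 + W₂) + 2 * (T.R1 + W₁) + π * Real.sqrt 2) * (W₁ + A₀ / (B.Dtmin - 2 * A₁))))) +
        3 * ((((4 + 0) * (A₀ / (B.Dtmin - 2 * A₁)) + 4 * A₂) * ((T.R2 + W₂) + 2 * (T.R1 + W₁) + π * Real.sqrt 2) ^ 2 +
          2 * (4 + 0) * ((T.R2 + W₂) + 2 * (T.R1 + W₁) + π * Real.sqrt 2) * (W₂ + 2 * W₁ + A₀ / (B.Dtmin - 2 * A₁)))) +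
        4 * ((((4 + 0) * (A₀ / (B.Dtmin - 2 * A₁)) + 4 * A₂) * ((T.R1 + W₁) + π * Real.sqrt 2) * ((T.R3 + W₃) + 3 * (T.R1 + W₁) + 3 * (T.R2 + W₂) + π * Real.sqrt 2) +
          (4 + 0) * ((W₁ + A₀ / (B.Dtmin - 2 * A₁)) * ((T.R3 + W₃) + 3 * (T.R1 + W₁) + 3 * (T.R2 + W₂) + π * Real.sqrt 2) +
            ((T.R1 + W₁) + π * Real.sqrt 2) * (W₃ + 3 * W₁ + 3 * W₂ + A₀ / (B.Dtmin - 2 * A₁))))) +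
        ((4 + 0) * (A₀ / (B.Dtmin - 2 * A₁)) + 2 * A₁) * (6 * (T.R2 + W₂) + 4 * (T.R3 + W₃) + 4 * (T.R1 + W₁) + π * Real.sqrt 2) +
        (4 + 2 * A₁) * (6 * W₂ + 4 * W₃ + 4 * W₁ + A₀ / (B.Dtmin - 2 * A₁)) +
        T.R4 * ((4 + 0) * (A₀ / (B.Dtmin - 2 * A₁)) + 2 * A₁)) / (B.Dtmin - 2 * A₁) ≤ W₄)
    (θ : ℝ) :
    |perturbedFermiRadius (fun p : Fin 2 → ℝ => -K.eval p) ν θ - bandFermiRadius ν θ| ≤ A₀ / (B.Dtmin - 2 * A₁) ∧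
    |deriv (perturbedFermiRadius (fun p : Fin 2 → ℝ => -K.eval p) ν) θ - deriv (bandFermiRadius ν) θ| ≤ W₁ ∧
    |deriv (deriv (perturbedFermiRadius (fun p : Fin 2 → ℝ => -K.eval p) ν)) θ - deriv (deriv (bandFermiRadius ν)) θ| ≤ W₂ ∧
    |deriv (deriv (deriv (perturbedFermiRadius (fun p : Fin 2 → ℝ => -K.eval p) ν))) θ -
        deriv (deriv (deriv (bandFermiRadius ν))) θ| ≤ W₃ ∧
    |deriv (deriv (deriv (deriv (perturbedFermiRadius (fun p : Fin 2 → ℝ => -K.eval p) ν)))) θ -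
        deriv (deriv (deriv (deriv (bandFermiRadius ν)))) θ| ≤ W₄ ∧
    perturbedFermiRadius (fun p : Fin 2 → ℝ => -K.eval p) ν θ ≤ T.umax + A₀ / (B.Dtmin - 2 * A₁) ∧
    |deriv (perturbedFermiRadius (fun p : Fin 2 → ℝ => -K.eval p) ν) θ| ≤ T.R1 + W₁ ∧
    |deriv (deriv (perturbedFermiRadius (fun p : Fin 2 → ℝ => -K.eval p) ν)) θ| ≤ T.R2 + W₂ ∧
    |deriv (deriv (deriv (perturbedFermiRadius (fun p : Fin 2 → ℝ => -K.eval p) ν))) θ| ≤ T.R3 + W₃ ∧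
    |deriv (deriv (deriv (deriv (perturbedFermiRadius (fun p : Fin 2 → ℝ => -K.eval p) ν)))) θ| ≤ T.R4 + W₄ :=
  frame_polar_tower_of_window B hA₀ hA₁ hA₂ hA₃ hA₄ hA₁Dt hlo hhi h.le_umax h.abs_deriv_le h.abs_deriv_two_le h.abs_deriv_three_le
    h.abs_deriv_four_le hW₁ hW₂ hW₃ hW₄ θ

end Bridge

end Summit.HubbardSuperconductivity.HubbardSuperconductivity.Theorems.PerturbedFermiCurve

end
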